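import Summits.HodgeConjecture.HodgeConjecture.Theorems.PadicSemiregularLiftFormalLiftingFromClassLiftingTowerCocycles
import Summits.HodgeConjecture.HodgeConjecture.Theorems.PadicSemiregularLiftFormalLiftingFromClassLiftingH1MapSurjective
import Literature.AlgebraicGeometry.KTheory.Determinant

/-!
# `FormalLiftingFromClassLifting` (stmt-HodgeConjecture-13825) · line `IdeatorFiveSketch` ·
# the sheaves `(ι_n)_* 𝒪_{X_n}` on `𝒳` and the surjectivity of `H¹` along the tower

Support file for stub S4 `stub_picKernelLift` ((2_Pic)) of the weight-one-first skeleton (lead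
prover-line-stmt-HodgeConjecture-13825-c1-0). For the thickenings `ι_n : X_n ↪ 𝒳` we consider the
abelian sheaves `(ι_n)_* 𝒪_{X_n}` on `𝒳` (continuous push-forward along `Opens.map ι_n`, written
out), the restriction `r_n : 𝒪_𝒳 → (ι_n)_* 𝒪_{X_n}` (`exists_restrictionHom`) and the transitions
`(ι_n)_* 𝒪 → (ι_m)_* 𝒪` for `m ≤ n` (`exists_transitionHom`), and prove: `H¹(𝒳, 𝒪) → H¹((ι_n)_* 𝒪)`
is onto for `𝒳` flat over `W` with `H²(𝒳, 𝒪)[p] = 0` (the landed S1 `stub_h1MapSurjective` with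
`q = pⁿ` and the cut-out equations of `X_n`), hence so are the transitions on `H¹`; and the
bookkeeping identity for restriction in the push-forward (`sheafSecRes_pushforward`, registered
support statement). A last section records the determinant side of weight one used by
`detClass_extends`: invariance of the Čech determinant class under isomorphism and the level-wise
lifts of a power of `det[E₁]` from the rational pro-class (`detPow_lifts_all_levels`). Everything is
proved; no definitions, no notation.
-/

set_option linter.dupNamespace false

namespace Summit.HodgeConjecture.HodgeConjecture.Theorems.FormalLiftingFromClassLifting.WeightOne

open CategoryTheory AlgebraicGeometry Limits Opposite TopologicalSpace
open Literature.AlgebraicGeometry Literature.AlgebraicGeometry.Motives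
open Literature.AlgebraicGeometry.Motives.WittScheme
open Literature.AlgebraicGeometry.Modules (CechPic detClass)
open Summit.HodgeConjecture.HodgeConjecture.Theorems.FormalVectorBundlesAlgebraize
  (thickeningι_cutOut mul_p_pow_injective_sections)

noncomputable section

universe u

section General

/-- `p`-torsion-freeness of an abelian group propagates to powers of `p`. -/
theorem pow_smul_eq_zero_imp {A : Type*} [AddCommGroup A] {p : ℕ}
    (h : ∀ x : A, (p : ℤ) • x = 0 → x = 0)
    (n : ℕ) (x : A) (hx : ((p : ℤ) ^ n) • x = 0) : x = 0 := by
  induction n generalizing x with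
  | zero => simpa using hx
  | succ n ih =>
    rw [pow_succ, mul_comm, mul_smul] at hx
    exact ih x (h _ hx)


end General

section Tower

variable {p : ℕ} [Fact p.Prime] {k : Type} [Field k] (𝒳 : SchemeOver (WittVector p k))

/-- `ι_m⁻¹ U ≤ t⁻¹ (ι_n⁻¹ U)` for the transition `t : X_m → X_n` (an equality, from `t ≫ ι_n = ι_m`). -/
theorem preimage_le_preimage_thickeningMap {m n : ℕ} (h : m ≤ n) (U : 𝒳.left.Opens) :
    (thickeningι 𝒳 m) ⁻¹ᵁ U ≤ (thickeningMap 𝒳 h) ⁻¹ᵁ ((thickeningι 𝒳 n) ⁻¹ᵁ U) := by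
  rw [← thickeningMap_ι 𝒳 h]
  exact le_rfl

/-- `r_n = r_n' ≫ (transition)` on sections: restricting from `𝒳` to `X_n` factors through `X_{n'}`. -/
theorem transition_app_apply {m n : ℕ} (h : m ≤ n) (U : 𝒳.left.Opens) (s : Γ(𝒳.left, U)) :
    (thickeningMap 𝒳 h).appLE _ _ (preimage_le_preimage_thickeningMap 𝒳 h U)
      ((thickeningι 𝒳 n).app U s) = (thickeningι 𝒳 m).app U s := by
  rw [← CategoryTheory.comp_apply, Scheme.Hom.app_eq_appLE, Scheme.Hom.appLE_comp_appLE,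
    appLE_congr_hom (thickeningMap_ι 𝒳 h) U, ← Scheme.Hom.app_eq_appLE]

/-- **The restriction `r_n : 𝒪_𝒳 → (ι_n)_* 𝒪_{X_n}`** as a morphism of abelian sheaves on `𝒳`,
characterised by its components. [folklore] -/
theorem exists_restrictionHom (n : ℕ) :
    ∃ r : structureSheafAb 𝒳.left ⟶
        (((Opens.map (thickeningι 𝒳 n).base).sheafPushforwardContinuous AddCommGrpCat.{0}
          (Opens.grothendieckTopology 𝒳.left)
          (Opens.grothendieckTopology (thickening 𝒳 n).left)).obj
          (structureSheafAb (thickening 𝒳 n).left)),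
      ∀ (U : 𝒳.left.Opens) (s : Γ(𝒳.left, U)), r.hom.app (op U) s = (thickeningι 𝒳 n).app U s :=
  ⟨ObjectProperty.homMk
    { app := fun U => AddCommGrpCat.ofHom ((thickeningι 𝒳 n).app U.unop).hom.toAddMonoidHom
      naturality := fun U V i => by
        ext s
        change (thickeningι 𝒳 n).app V.unop (𝒳.left.presheaf.map i s) =
          (thickening 𝒳 n).left.presheaf.map ((Opens.map (thickeningι 𝒳 n).base).map i.unop).op
            ((thickeningι 𝒳 n).app U.unop s)
        rw [← CategoryTheory.comp_apply, (thickeningι 𝒳 n).naturality i,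
          CategoryTheory.comp_apply] }, fun _ _ => rfl⟩

/-- **The transition `(ι_n)_* 𝒪_{X_n} → (ι_m)_* 𝒪_{X_m}`** (`m ≤ n`) as a morphism of abelian sheaves
on `𝒳`, characterised by its components (`Scheme.Hom.appLE` of `X_m → X_n`). [folklore] -/
theorem exists_transitionHom {m n : ℕ} (h : m ≤ n) :
    ∃ t : (((Opens.map (thickeningι 𝒳 n).base).sheafPushforwardContinuous AddCommGrpCat.{0}
          (Opens.grothendieckTopology 𝒳.left)
          (Opens.grothendieckTopology (thickening 𝒳 n).left)).obj
          (structureSheafAb (thickening 𝒳 n).left)) ⟶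
        (((Opens.map (thickeningι 𝒳 m).base).sheafPushforwardContinuous AddCommGrpCat.{0}
          (Opens.grothendieckTopology 𝒳.left)
          (Opens.grothendieckTopology (thickening 𝒳 m).left)).obj
          (structureSheafAb (thickening 𝒳 m).left)),
      ∀ (U : 𝒳.left.Opens) (s : Γ((thickening 𝒳 n).left, (thickeningι 𝒳 n) ⁻¹ᵁ U)),
        t.hom.app (op U) s =
          (thickeningMap 𝒳 h).appLE _ _ (preimage_le_preimage_thickeningMap 𝒳 h U) s :=
  ⟨ObjectProperty.homMk
    { app := fun U => AddCommGrpCat.ofHom ((thickeningMap 𝒳 h).appLE _ _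
        (preimage_le_preimage_thickeningMap 𝒳 h U.unop)).hom.toAddMonoidHom
      naturality := fun U V i => by
        ext s
        change (thickeningMap 𝒳 h).appLE _ _ _ ((thickening 𝒳 _).left.presheaf.map
            ((Opens.map (thickeningι 𝒳 _).base).map i.unop).op s) =
          (thickening 𝒳 _).left.presheaf.map ((Opens.map (thickeningι 𝒳 _).base).map i.unop).op
            ((thickeningMap 𝒳 h).appLE _ _ _ s)
        rw [← CategoryTheory.comp_apply, ← CategoryTheory.comp_apply, Scheme.Hom.map_appLE,
          Scheme.Hom.appLE_map] }, fun _ _ => rfl⟩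

/-- **`H¹(𝒳, 𝒪) → H¹((ι_n)_* 𝒪_{X_n})` is onto** for `𝒳` flat over `W` with `H²(𝒳, 𝒪)` `p`-torsion-free
(the landed S1 with `q = pⁿ`: `r_n` is affine-locally onto with kernel `pⁿ Γ` by `thickeningι_cutOut`). -/
theorem surjective_H_map_restriction [CharP k p] [Flat 𝒳.hom]
    (hO : ∀ x : structureSheafCohomology 𝒳.left 2, (p : ℤ) • x = 0 → x = 0) (n : ℕ)
    (r : structureSheafAb 𝒳.left ⟶
      (((Opens.map (thickeningι 𝒳 n).base).sheafPushforwardContinuous AddCommGrpCat.{0}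
          (Opens.grothendieckTopology 𝒳.left)
          (Opens.grothendieckTopology (thickening 𝒳 n).left)).obj
          (structureSheafAb (thickening 𝒳 n).left)))
    (hr : ∀ (U : 𝒳.left.Opens) (s : Γ(𝒳.left, U)), r.hom.app (op U) s = (thickeningι 𝒳 n).app U s) :
    Function.Surjective (Sheaf.H.map r 1 : Sheaf.H.{0} (structureSheafAb 𝒳.left) 1 →
      Sheaf.H.{0} (((Opens.map (thickeningι 𝒳 n).base).sheafPushforwardContinuous AddCommGrpCat.{0}
          (Opens.grothendieckTopology 𝒳.left)
          (Opens.grothendieckTopology (thickening 𝒳 n).left)).obj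
          (structureSheafAb (thickening 𝒳 n).left)) 1) := by
  refine stub_h1MapSurjective 𝒳.left (p ^ n) (fun U _ s hs => ?_) (fun x hx => ?_) _ _
    (fun U hU => ?_) (fun U hU s => ?_)
  · refine mul_p_pow_injective_sections 𝒳 U n s ?_
    rw [← Nat.cast_pow, ← nsmul_eq_mul]
    exact hs
  · exact pow_smul_eq_zero_imp hO n x (by rwa [Nat.cast_pow] at hx)
  · intro y
    obtain ⟨s, hs⟩ := (thickeningι_cutOut 𝒳 n hU).1 y
    exact ⟨s, (hr U s).trans hs⟩
  · have e0 : r.hom.app (op U) s = 0 ↔ (thickeningι 𝒳 n).app U s = 0 := by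
      rw [hr U s]
      exact Iff.rfl
    refine e0.trans ?_
    rw [(thickeningι_cutOut 𝒳 n hU).2 s]
    refine exists_congr fun t => ?_
    rw [map_natCast]
    exact iff_of_eq (congrArg (fun r => s = r) ((nsmul_eq_mul (p ^ n) t).symm))

set_option maxHeartbeats 800000 in -- buildfix 2026-08-19: `whnf` timeout at 200000 heartbeats under `lake build` (decl at :148)
/-- **The transition `H¹((ι_n)_* 𝒪) → H¹((ι_m)_* 𝒪)` (`m ≤ n`) is onto** under the same hypotheses
(the restriction `r_m` factors through it). -/
theorem surjective_H_map_transition [CharP k p] [Flat 𝒳.hom]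
    (hO : ∀ x : structureSheafCohomology 𝒳.left 2, (p : ℤ) • x = 0 → x = 0) {m n : ℕ} (h : m ≤ n)
    (t : (((Opens.map (thickeningι 𝒳 n).base).sheafPushforwardContinuous AddCommGrpCat.{0}
          (Opens.grothendieckTopology 𝒳.left)
          (Opens.grothendieckTopology (thickening 𝒳 n).left)).obj
          (structureSheafAb (thickening 𝒳 n).left)) ⟶
      (((Opens.map (thickeningι 𝒳 m).base).sheafPushforwardContinuous AddCommGrpCat.{0}
          (Opens.grothendieckTopology 𝒳.left)
          (Opens.grothendieckTopology (thickening 𝒳 m).left)).obj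
          (structureSheafAb (thickening 𝒳 m).left)))
    (ht : ∀ (U : 𝒳.left.Opens) (s : Γ((thickening 𝒳 n).left, (thickeningι 𝒳 n) ⁻¹ᵁ U)),
      t.hom.app (op U) s = (thickeningMap 𝒳 h).appLE _ _ (preimage_le_preimage_thickeningMap 𝒳 h U) s) :
    Function.Surjective (Sheaf.H.map t 1 : Sheaf.H.{0} (((Opens.map (thickeningι 𝒳 n).base).sheafPushforwardContinuous AddCommGrpCat.{0}
          (Opens.grothendieckTopology 𝒳.left)
          (Opens.grothendieckTopology (thickening 𝒳 n).left)).obj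
          (structureSheafAb (thickening 𝒳 n).left)) 1 →
      Sheaf.H.{0} (((Opens.map (thickeningι 𝒳 m).base).sheafPushforwardContinuous AddCommGrpCat.{0}
          (Opens.grothendieckTopology 𝒳.left)
          (Opens.grothendieckTopology (thickening 𝒳 m).left)).obj
          (structureSheafAb (thickening 𝒳 m).left)) 1) := by
  obtain ⟨rn, hrn⟩ := exists_restrictionHom 𝒳 n
  obtain ⟨rm, hrm⟩ := exists_restrictionHom 𝒳 m
  have hfac : rn ≫ t = rm := by
    refine Sheaf.hom_ext (NatTrans.ext (funext fun ⟨U⟩ => ?_))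
    ext s
    change t.hom.app (op U) (rn.hom.app (op U) s) = rm.hom.app (op U) s
    rw [hrn U s, ht U, hrm U s]
    exact transition_app_apply 𝒳 h U s
  intro y
  obtain ⟨x, hx⟩ := surjective_H_map_restriction 𝒳 hO m rm hrm y
  exact ⟨Sheaf.H.map rn 1 x, by rw [← Sheaf.H.map_comp_apply, hfac, hx]⟩

/-- **Restriction in `(ι_n)_* 𝒪` is restriction of sections of `X_n` along preimages** (registered
support statement of the line; definitional). -/
theorem sheafSecRes_pushforward :
    ∀ (p : ℕ) [Fact p.Prime] (k : Type) [Field k] (𝒳 : SchemeOver (WittVector p k)) (n : ℕ)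
      (U V : 𝒳.left.Opens) (h : V ≤ U)
      (t : (((Opens.map (thickeningι 𝒳 n).base).sheafPushforwardContinuous AddCommGrpCat.{0}
        (Opens.grothendieckTopology 𝒳.left)
        (Opens.grothendieckTopology (thickening 𝒳 n).left)).obj
        (structureSheafAb (thickening 𝒳 n).left)).obj.obj (op U)),
      sheafSecRes (((Opens.map (thickeningι 𝒳 n).base).sheafPushforwardContinuous AddCommGrpCat.{0}
        (Opens.grothendieckTopology 𝒳.left)
        (Opens.grothendieckTopology (thickening 𝒳 n).left)).obj
        (structureSheafAb (thickening 𝒳 n).left)) h t =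
      (thickening 𝒳 n).left.presheaf.map
        (homOfLE (show (thickeningι 𝒳 n) ⁻¹ᵁ V ≤ (thickeningι 𝒳 n) ⁻¹ᵁ U from fun _ hq => h hq)).op t :=
  fun _ _ _ _ _ _ _ _ _ _ => rfl

end Tower

section DetFamily

variable {p : ℕ} [Fact p.Prime] {k : Type} [Field k] [CharP k p] [PerfectRing k p]
  (𝒳 : SchemeOver (WittVector p k))

/-- The determinant class is invariant under isomorphism (through `K₀`: `[E] = [E']` and
`det [E] = [det E]`). [folklore] -/
theorem detClass_eq_of_iso {X : Scheme.{u}} {E E' : X.Modules} (e : E ≅ E')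
    (hE : IsFiniteLocallyFree E) (hE' : IsFiniteLocallyFree E') : detClass hE = detClass hE' := by
  have h := congrArg KTheory.KZero.det (KTheory.KZero.of_iso e hE hE')
  rw [KTheory.KZero.det_of, KTheory.KZero.det_of] at h
  exact Additive.ofMul.injective h

omit [PerfectRing k p] in
/-- **Level-wise lifts of a power of `det[E₁]`.** If the rational class of `E₁` pro-lifts, then for
some `N ≥ 1` and every `n` the class `det[E₁]^N ∈ Ȟ¹(X_k, 𝒪^×)` is the restriction of a class on
`X_{n+1}` (apply `det : K₀ → Ȟ¹(𝒪^×)`, natural under pull-back, to the integral multiple of the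
pro-class provided by `Negative.exists_int_multiple_lifts_all_levels`). [folklore] -/
theorem detPow_lifts_all_levels {E₁ : (specialFibre 𝒳).left.Modules} (hE₁ : IsFiniteLocallyFree E₁)
    (hξ : ∃ ξ : KTheory.ContinuousKZeroRat (Ideal.span {(p : WittVector p k)}) 𝒳,
      KTheory.KZeroRat.map (Crystalline.specialFibreToTower 𝒳)
        (KTheory.ContinuousKZeroRat.specialFibre (Ideal.span {(p : WittVector p k)}) 𝒳 ξ) =
        KTheory.KZeroRat.of E₁ hE₁) :
    ∃ N : ℕ, 0 < N ∧ ∀ n : ℕ, ∃ c : CechPic (thickening 𝒳 (n + 1)).left,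
      CechPic.pullback (specialFibreToThickening 𝒳 n) c = detClass hE₁ ^ N := by
  obtain ⟨M, hM, h⟩ := Negative.exists_int_multiple_lifts_all_levels hE₁ hξ
  refine ⟨M.natAbs, Int.natAbs_pos.mpr hM, fun n => ?_⟩
  obtain ⟨z, hz⟩ := h n
  refine ⟨Additive.toMul (KTheory.KZero.det (M.sign • z)), ?_⟩
  have h1 : KTheory.KZero.map (specialFibreToThickening 𝒳 n) (M.sign • z) =
      (M.natAbs : ℤ) • KTheory.KZero.of E₁ hE₁ := by
    rw [map_zsmul, hz, smul_smul, Int.sign_mul_self_eq_natAbs]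
  have h2 := congrArg KTheory.KZero.det h1
  rw [KTheory.KZero.det_map, map_zsmul KTheory.KZero.det (M.natAbs : ℤ) (KTheory.KZero.of E₁ hE₁),
    KTheory.KZero.det_of, natCast_zsmul, ← ofMul_pow] at h2
  exact Additive.ofMul.injective h2

end DetFamily

end

end Summit.HodgeConjecture.HodgeConjecture.Theorems.FormalLiftingFromClassLifting.WeightOne
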